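import Summits.BirchSwinnertonDyer.BirchSwinnertonDyer.Theorems.ManinLocalTwoThreeManinOddAtFourDyadicLevelMinimal
import Summits.BirchSwinnertonDyer.BirchSwinnertonDyer.Theorems.ManinLocalTwoThreeSameLevelTwistTransport
import HarnessLib

/-!
# Route `ManinLocalTwoThree` (cell `bsd-f2-manin`): crux C2 `ManinOddAtFour` (stmt-BirchSwinnertonDyer-22967)
# REDUCED to Manin's conjecture at `2` on the TWIST-ORBIT-MINIMAL optimal classes

Strengthening of `maninLocalTwoThree_maninOddAtFour_of_dyadicLevelMinimal` (same seat, same day) by two more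
exact transports, both kernel-checked in the tree:
* clause (iv) (aligned `χ±8`-untwist to a lattice-optimal additive curve `A`, `Δ(C) = d⁶Δ(A)` for the minimal
  model `C ∼ W` of `A ⊗ ℚ(√d)`) now covers, besides `N(A) < N`, every same-level partner with
  `|Δ_min(A)| < |Δ_min(W)|` (commuting partners `C = W` automatically; flip partners by the `|Δ|` tie-break);
* clause (v) (NEW): an aligned `χ_{q*}`-untwist at ANY odd prime `q` with `q² ∣ N` — a lattice-optimal `A` at
  the same level with `C = u • (A ⊗ ℚ(√q*))` globally minimal, `C ∼ W`, `Δ(C) = (q*)⁶ Δ(A)` and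
  `|Δ_min(A)| < |Δ_min(W)|` — transports `2 ∤ c` by the cell's THEOREM A clause 1
  (`maninLocalTwoThree_not_dvd_maninConstant_of_untwist_pStar_aligned`, prime-generic).
Main theorem `maninLocalTwoThree_maninOddAtFour_of_twistOrbitMinimal`: the route decl BY NAME from ONE
hypothesis — `2 ∤ c` on the lattice-optimal data with `4 ∣ N` admitting none of the untwists (i)–(v).
Lexicographic induction on (level, `|Δ_min|`).

CENSUS of the residue (this seat's exact join of the cell table TWISTCENSUS2 — alignment tested on the
a-invariants, `Δ(C) = d⁶Δ(A)` exactly; HOME/…/p2 script census3.py; optimal classes with `4 ∣ N ≤ 5·10⁵`):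
all 897 670 → dyadically twist-minimal 700 867 → globally twist-minimal 487 948 (seat p1's `H₂`) →
dyadic-level-minimal 320 383 → **TWIST-ORBIT-MINIMAL 259 325** (28.9 % of all), by `v₂(N)`: `2`: 93 890 ·
`3`: 95 159 · `4`: 0 · `5`: 46 523 · `6`: 8 399 · `7`: 10 560 · `8`: 4 794; `W[2]`-reducible among them: 65 251.
What is left is Manin's conjecture at `2` for the optimal curves that are minimal for (conductor, `|Δ_min|`)
in their whole quadratic-twist class — OPEN; nothing here proves BSD or Manin's conjecture.
Seat bsd-line-manin23-p2 (gen 2).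

References: [Stevens1989] Lemmas (5.2), (5.4); [Cesnavicius2018] Thm. 1.2; [Pal2012] Prop. 2.4, Lemma 3.1;
[SilvermanATAEC1994] IV.9.4.
-/

set_option autoImplicit false
set_option linter.dupNamespace false

noncomputable section

open scoped MatrixGroups ModularForm Classical NumberField

namespace Summit.BirchSwinnertonDyer.BirchSwinnertonDyer.Theorems

open CongruenceSubgroup WeierstrassCurve IsDedekindDomain IsDedekindDomain.HeightOneSpectrum
  Rat.HeightOneSpectrum Literature.NumberTheory.Automorphic
  Literature.NumberTheory.EllipticCurves Literature.NumberTheory.EllipticCurves.ModularForms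
  Summit.BirchSwinnertonDyer.Rank1Residual.ManinAdditive

/-- **Crux C2 `ManinOddAtFour` ⟸ Manin's conjecture at `2` on the TWIST-ORBIT-MINIMAL optimal classes**
(one hypothesis, kernel-checked composition). Modulo the four printed facts, it suffices to prove `2 ∤ c` for
the lattice-optimal data `D` with `4 ∣ N` whose class admits (i) no dyadic untwist to a class semistable at
`2`; (ii) no odd semistable untwist `χ_{q*}` (`q ≠ 2`, `q² ∣ N`); (iii) no `χ₋₄`-untwist to an ADDITIVE class
of LOWER conductor `N' ∣ N` (`2⁴ ∣ N`); (iv) no ALIGNED `χ±8`-untwist (`2⁶ ∣ N`) to a lattice-optimal additive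
`A` with `N(A) ∣ N` — minimal model `C ∼ W` of `A ⊗ ℚ(√±2)` with `Δ(C) = d⁶Δ(A)` — which has lower conductor
or `|Δ_min(A)| < |Δ_min(W)|`; (v) no ALIGNED same-level `χ_{q*}`-untwist (`q` odd prime, `q² ∣ N`) to a
lattice-optimal `A` with `C = u • (A ⊗ ℚ(√q*)) ∼ W` globally minimal, `Δ(C) = (q*)⁶Δ(A)`,
`|Δ_min(A)| < |Δ_min(W)|`. Lexicographic induction on (level, `|Δ_min|`): (i) is closed by print
(`maninLocalTwoThree_maninOddAtFour_twistCovered`), (ii)/(iii)/(iv, lower) move `2 ∤ c` up from a lower level,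
(iv, same level)/(v) from a partner with smaller `|Δ_min|`. Residue census: 259 325 of the 897 670 optimal
classes with `4 ∣ N ≤ 5·10⁵` (`v₂(N) ∈ {2, 3, 5, 6, 7, 8}`). OPEN on that residue.
[cite: Stevens1989, Lemmas (5.2), (5.4)] [cite: Cesnavicius2018, Thm. 1.2] [cite: Pal2012, Prop. 2.4, Lemma 3.1] -/
theorem maninLocalTwoThree_maninOddAtFour_of_twistOrbitMinimal
    (H : Literature.NumberTheory.EllipticCurves.ModularForms.mazur_not_dvd_maninConstant_of_odd →
      Literature.NumberTheory.EllipticCurves.ModularForms.abbesUllmo_not_dvd_maninConstant_of_not_dvd_level →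
      Literature.NumberTheory.EllipticCurves.ModularForms.cesnavicius_not_two_dvd_maninConstant_of_two_dvd_level →
      Literature.NumberTheory.EllipticCurves.ModularForms.exists_isNewformOf →
      ∀ (W : WeierstrassCurve ℚ) [W.IsElliptic] [W.IsGloballyMinimal] {N : ℕ} [NeZero N]
        (D : ModularParametrizationData W N),
        (∀ z ∈ D.L.lattice, ∃ w ∈ periodLattice D.f, z = D.c * w) → 2 ^ 2 ∣ N →
        ¬ (∃ (W' : WeierstrassCurve ℚ) (d : ℤ), W'.IsElliptic ∧ W'.IsGloballyMinimal ∧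
          (d = -1 ∨ d = 2 ∨ d = -2) ∧ IsIsogenous W (W'.quadraticTwist (d : ℚ)) ∧
          ¬ 2 ^ 2 ∣ W'.conductorNorm ℤ) →
        ¬ (∃ (W' : WeierstrassCurve ℚ) (q : ℕ), W'.IsElliptic ∧ W'.IsGloballyMinimal ∧
          q.Prime ∧ q ≠ 2 ∧ q ^ 2 ∣ N ∧
          IsIsogenous W (W'.quadraticTwist (((-1 : ℤ) ^ (q / 2) * q : ℤ) : ℚ)) ∧
          ¬ q ^ 2 ∣ W'.conductorNorm ℤ) →
        ¬ (∃ (A : WeierstrassCurve ℚ), A.IsElliptic ∧ A.IsGloballyMinimal ∧ 2 ^ 4 ∣ N ∧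
          2 ^ 2 ∣ A.conductorNorm ℤ ∧ A.conductorNorm ℤ ∣ N ∧ A.conductorNorm ℤ < N ∧
          IsIsogenous W (A.quadraticTwist ((-1 : ℤ) : ℚ))) →
        ¬ (∃ (A : WeierstrassCurve ℚ) (_ : A.IsElliptic) (_ : A.IsGloballyMinimal) (N' : ℕ) (_ : NeZero N')
          (D' : ModularParametrizationData A N') (d : ℤ) (C : WeierstrassCurve ℚ) (u : VariableChange ℚ),
          C.IsElliptic ∧ C.IsGloballyMinimal ∧
          (∀ z ∈ D'.L.lattice, ∃ w ∈ periodLattice D'.f, z = D'.c * w) ∧ (d = 2 ∨ d = -2) ∧ 2 ^ 6 ∣ N ∧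
          2 ^ 2 ∣ A.conductorNorm ℤ ∧ A.conductorNorm ℤ ∣ N ∧
          IsIsogenous W (A.quadraticTwist (d : ℚ)) ∧ u • A.quadraticTwist (d : ℚ) = C ∧
          C.Δ = (d : ℚ) ^ 6 * A.Δ ∧
          (A.conductorNorm ℤ < N ∨ A.minimalDiscriminantInt.natAbs < W.minimalDiscriminantInt.natAbs)) →
        ¬ (∃ (A : WeierstrassCurve ℚ) (_ : A.IsElliptic) (_ : A.IsGloballyMinimal)
          (D' : ModularParametrizationData A N) (q : ℕ) (C : WeierstrassCurve ℚ) (u : VariableChange ℚ),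
          C.IsElliptic ∧ C.IsGloballyMinimal ∧
          (∀ z ∈ D'.L.lattice, ∃ w ∈ periodLattice D'.f, z = D'.c * w) ∧ q.Prime ∧ q ≠ 2 ∧ q ^ 2 ∣ N ∧
          IsIsogenous C W ∧ u • A.quadraticTwist (((-1 : ℤ) ^ (q / 2) * q : ℤ) : ℚ) = C ∧
          C.Δ = ((((-1 : ℤ) ^ (q / 2) * q : ℤ)) : ℚ) ^ 6 * A.Δ ∧
          A.minimalDiscriminantInt.natAbs < W.minimalDiscriminantInt.natAbs) →
        ¬ (2 : ℤ) ∣ D.maninConstant) :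
    Summit.BirchSwinnertonDyer.BirchSwinnertonDyer.Theses.ManinLocalTwoThree.ManinOddAtFour := by
  intro hM hAU hC2 hnf
  suffices key : ∀ (n m : ℕ) (W : WeierstrassCurve ℚ) [W.IsElliptic] [W.IsGloballyMinimal] (N : ℕ)
      [NeZero N] (D : ModularParametrizationData W N), N < n → W.minimalDiscriminantInt.natAbs < m →
      (∀ z ∈ D.L.lattice, ∃ w ∈ periodLattice D.f, z = D.c * w) → 2 ^ 2 ∣ N →
      ¬ (2 : ℤ) ∣ D.maninConstant by
    intro W _ _ N _ D hopt h4
    exact key (N + 1) (W.minimalDiscriminantInt.natAbs + 1) W N D (Nat.lt_succ_self N)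
      (Nat.lt_succ_self _) hopt h4
  intro n
  induction n with
  | zero => intro m W _ _ N _ D hN; exact absurd hN (Nat.not_lt_zero N)
  | succ n ihN =>
    intro m
    induction m with
    | zero => intro W _ _ N _ D _ hm; exact absurd hm (Nat.not_lt_zero _)
    | succ m ihm =>
    intro W _ _ N _ D hNn hmm hopt h4
    have hN : N = W.conductorNorm ℤ :=
      IsNewformOf.level_eq_conductorNorm_of_exists_isNewformOf hnf D.isNewformOf
    -- (i) a dyadic untwist to a class semistable at `2`: closed (twist-covered half)
    by_cases h1 : ∃ (W' : WeierstrassCurve ℚ) (d : ℤ), W'.IsElliptic ∧ W'.IsGloballyMinimal ∧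
        (d = -1 ∨ d = 2 ∨ d = -2) ∧ IsIsogenous W (W'.quadraticTwist (d : ℚ)) ∧
        ¬ 2 ^ 2 ∣ W'.conductorNorm ℤ
    · exact maninLocalTwoThree_maninOddAtFour_twistCovered hM hAU hC2 hnf W D hopt h4 h1
    -- (ii) an odd semistable untwist: transport + induction on the level
    by_cases h2 : ∃ (W' : WeierstrassCurve ℚ) (q : ℕ), W'.IsElliptic ∧ W'.IsGloballyMinimal ∧
        q.Prime ∧ q ≠ 2 ∧ q ^ 2 ∣ N ∧
        IsIsogenous W (W'.quadraticTwist (((-1 : ℤ) ^ (q / 2) * q : ℤ) : ℚ)) ∧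
        ¬ q ^ 2 ∣ W'.conductorNorm ℤ
    · obtain ⟨W', q, hE', hM', hqp, hq2, hqN, htw, hqN'⟩ := h2
      haveI := hE'
      haveI := hM'
      haveI : Fact q.Prime := ⟨hqp⟩
      refine maninLocalTwoThree_not_dvd_maninConstant_of_oddUntwist hnf hq2 D hopt hqN htw hqN' ?_
      intro W₁ _ _ N₁ _ D₁ hiso₁ hopt₁
      have hN₁ : N₁ = W'.conductorNorm ℤ := level_eq_conductorNorm_of_isIsogenous hnf D₁ hiso₁
      have hqNW : q ^ 2 ∣ W.conductorNorm ℤ := hN ▸ hqN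
      have hadd : ¬ W.HasGoodReductionAtPrime q ∧ ¬ W.HasMultiplicativeReductionAtPrime q :=
        not_good_and_not_mult_of_sq_dvd_conductorNorm W hqNW
      have hN'N : W'.conductorNorm ℤ ∣ W.conductorNorm ℤ :=
        maninLocalTwoThree_conductorNorm_dvd_of_isIsogenous_twist_pStar hnf hq2 htw hqN' hadd
      have hlt : N₁ < N := by
        rw [hN₁, hN]
        refine lt_of_le_of_ne (Nat.le_of_dvd (conductorNorm_pos_holds W) hN'N) fun h ↦ hqN' ?_
        rw [h]; exact hqNW
      have h4₁ : 2 ^ 2 ∣ N₁ := by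
        rw [hN₁]
        exact maninLocalTwoThree_four_dvd_conductorNorm_of_isIsogenous_twist_pStar hnf hq2 htw (hN ▸ h4)
      exact ihN _ W₁ N₁ D₁ (by omega) (Nat.lt_succ_self _) hopt₁ h4₁
    -- (iii) a `χ₋₄`-untwist to an additive class of lower conductor: transport + induction on the level
    by_cases h3 : ∃ (A : WeierstrassCurve ℚ), A.IsElliptic ∧ A.IsGloballyMinimal ∧ 2 ^ 4 ∣ N ∧
        2 ^ 2 ∣ A.conductorNorm ℤ ∧ A.conductorNorm ℤ ∣ N ∧ A.conductorNorm ℤ < N ∧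
        IsIsogenous W (A.quadraticTwist ((-1 : ℤ) : ℚ))
    · obtain ⟨A, hAe, hAm, h16, h4A, hAN, hlt, htw⟩ := h3
      haveI := hAe
      haveI := hAm
      refine maninLocalTwoThree_not_dvd_maninConstant_of_additiveUntwist_negOne hnf D hopt h16 htw h4A
        hAN ?_
      intro W₁ _ _ N₁ _ D₁ hiso₁ hopt₁
      have hN₁ : N₁ = A.conductorNorm ℤ := level_eq_conductorNorm_of_isIsogenous hnf D₁ hiso₁
      exact ihN _ W₁ N₁ D₁ (by omega) (Nat.lt_succ_self _) hopt₁ (hN₁ ▸ h4A)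
    -- (iv) an aligned `χ±8`-untwist to a lattice-optimal additive curve, lower or with smaller `|Δ_min|`
    by_cases h5 : ∃ (A : WeierstrassCurve ℚ) (_ : A.IsElliptic) (_ : A.IsGloballyMinimal) (N' : ℕ)
        (_ : NeZero N') (D' : ModularParametrizationData A N') (d : ℤ) (C : WeierstrassCurve ℚ)
        (u : VariableChange ℚ),
        C.IsElliptic ∧ C.IsGloballyMinimal ∧
        (∀ z ∈ D'.L.lattice, ∃ w ∈ periodLattice D'.f, z = D'.c * w) ∧ (d = 2 ∨ d = -2) ∧ 2 ^ 6 ∣ N ∧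
        2 ^ 2 ∣ A.conductorNorm ℤ ∧ A.conductorNorm ℤ ∣ N ∧
        IsIsogenous W (A.quadraticTwist (d : ℚ)) ∧ u • A.quadraticTwist (d : ℚ) = C ∧
        C.Δ = (d : ℚ) ^ 6 * A.Δ ∧
        (A.conductorNorm ℤ < N ∨ A.minimalDiscriminantInt.natAbs < W.minimalDiscriminantInt.natAbs)
    · obtain ⟨A, hAe, hAm, N', hN'0, D', d, C, u, hCe, hCm, hopt', hd, h64, h4A, hAN, htw, hu, hΔ, hlow⟩ :=
        h5
      haveI := hCe
      haveI := hCm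
      have hN' : N' = A.conductorNorm ℤ :=
        IsNewformOf.level_eq_conductorNorm_of_exists_isNewformOf hnf D'.isNewformOf
      refine maninLocalTwoThree_not_dvd_maninConstant_of_additiveUntwist_two_aligned hnf D hopt h64 hd
        D' htw h4A hAN u hu hΔ ?_
      have h4N' : 2 ^ 2 ∣ N' := hN' ▸ h4A
      by_cases hlt : A.conductorNorm ℤ < N
      · exact ihN _ A N' D' (by omega) (Nat.lt_succ_self _) hopt' h4N'
      · have hmA : A.minimalDiscriminantInt.natAbs < W.minimalDiscriminantInt.natAbs := hlow.resolve_left hlt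
        have hle : N' ≤ N := hN' ▸ Nat.le_of_dvd (Nat.pos_of_ne_zero (NeZero.ne N)) hAN
        exact ihm A N' D' (by omega) (by omega) hopt' h4N'
    -- (v) an aligned same-level `χ_{q*}`-untwist (odd `q`, `q² ∣ N`) with smaller `|Δ_min|`
    by_cases h6 : ∃ (A : WeierstrassCurve ℚ) (_ : A.IsElliptic) (_ : A.IsGloballyMinimal)
        (D' : ModularParametrizationData A N) (q : ℕ) (C : WeierstrassCurve ℚ) (u : VariableChange ℚ),
        C.IsElliptic ∧ C.IsGloballyMinimal ∧
        (∀ z ∈ D'.L.lattice, ∃ w ∈ periodLattice D'.f, z = D'.c * w) ∧ q.Prime ∧ q ≠ 2 ∧ q ^ 2 ∣ N ∧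
        IsIsogenous C W ∧ u • A.quadraticTwist (((-1 : ℤ) ^ (q / 2) * q : ℤ) : ℚ) = C ∧
        C.Δ = ((((-1 : ℤ) ^ (q / 2) * q : ℤ)) : ℚ) ^ 6 * A.Δ ∧
        A.minimalDiscriminantInt.natAbs < W.minimalDiscriminantInt.natAbs
    · obtain ⟨A, hAe, hAm, D', q, C, u, hCe, hCm, hopt', hqp, hq2, hqN, hCW, hu, hΔ, hmA⟩ := h6
      haveI := hCe
      haveI := hCm
      haveI : Fact q.Prime := ⟨hqp⟩
      have hadd : ¬ W.HasGoodReductionAtPrime q ∧ ¬ W.HasMultiplicativeReductionAtPrime q :=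
        not_good_and_not_mult_of_sq_dvd_conductorNorm W (hN ▸ hqN)
      refine maninLocalTwoThree_not_dvd_maninConstant_of_untwist_pStar_aligned hq2 D hopt D' dvd_rfl hqN
        hadd u hu hCW hΔ ?_
      exact ihm A N D' hNn (by omega) hopt' h4
    · exact H hM hAU hC2 hnf W D hopt h4 h1 h2 h3 h5 h6

end Summit.BirchSwinnertonDyer.BirchSwinnertonDyer.Theorems

end
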